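import Summits.RiemannHypothesis.RiemannHypothesis.Theorems.SoloInformedAnticlusteringLaw
import Literature.NumberTheory.LFunctions.ZetaArgVariation
import Literature.NumberTheory.LFunctions.LittlewoodOscillationInputsAverageProofs
import HarnessLib

/-!
# RH + simple, polynomially separated zeros ⟹ the double-exponential lower size law (T69)

`SoloInformedAnticlusteringLaw` (T68) proves: RH together with the anti-clustering hypothesis
(AC*) — every window `[t, t + V]` with `(log t)^n ≤ V ≤ t`, `t ≥ t⋆`, carries `≥ c V log V`
ordinates of zeros, pairwise `≥ e^{-V}` apart — gives `Re Q(g) ≥ exp(-exp(A a))` for every unit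
Weil test function supported in `[-a, a]`, `a ≥ 1`.

Here (AC*) (with `n = 2`, `c = 1/(4π)`) is DERIVED, inside the kernel, from three classical
statements:

* RH (Mathlib's `RiemannHypothesis`);
* (SZ) every zero `ρ` of `ζ` with `Im ρ > 0` is simple (`riemannZetaZeroOrder ρ = 1`);
* (SG_k) distinct ordinates `γ ≠ γ'` of zeros beyond a height `t₀` satisfy
  `|γ - γ'| ≥ (max γ γ')^{-k}` for some fixed `k : ℕ`

— using the tree's THEOREM `riemann_von_mangoldt_holds`
(`N(T) = (T/2π) log(T/2π) − T/2π + O(log T)`,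
`Literature/NumberTheory/LFunctions/ZetaArgVariation`).
The window count `N(t+V) − N(t) ≥ (V/2π)(log t − 3) − C(2 log t + 1)` is
`exists_zetaZeroCount_window_ge`; under RH + (SZ) the zeros in the window are `½ + iγ` with
distinct `γ`, as many as `N(t+V) − N(t)` (`exists_finset_ordinates_window`); (SG_k) gives the
separation `e^{-V}` once `V ≥ (log t)² ≥ k log(2t)`.  The corollary
`weilQuadratic_re_ge_exp_neg_exp_of_simple_separated_zeros` is then T68 verbatim:
RH + (SZ) + (SG_k) ⟹ `∃ A > 0, ∀ a ≥ 1, … Re Q(g) ≥ exp(−exp(A a))`, matching the unconditional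
upper law `ε(a) ≤ exp(−c e^{a/2})` in shape (double exponential).  (SG_k) for every `k ≥ 1` is
predicted by the GUE statistics of small gaps; no theorem towards it is known or claimed.
-/

open Complex Set MeasureTheory Filter Asymptotics
open Literature.NumberTheory.LFunctions
open scoped Real

namespace Summit.RiemannHypothesis.RiemannHypothesis.Theorems

/-- Under (SZ) the multiplicity count `N(T)` is the number of distinct zeros in the box
`0 < Im ρ ≤ T`. -/
theorem zetaZeroCount_eq_card_of_simple
    (hSZ : ∀ ρ : ℂ, riemannZeta ρ = 0 → 0 < ρ.im → riemannZetaZeroOrder ρ = 1) (T : ℝ) :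
    zetaZeroCount T = (zetaZeroBox_finite 0 T).toFinset.card := by
  unfold zetaZeroCount zetaZeroCountRe
  rw [finsum_mem_eq_finite_toFinset_sum _ (zetaZeroBox_finite 0 T)]
  rw [Finset.sum_congr rfl (g := fun _ ↦ (1 : ℤ)) ?_]
  · simp
  · intro ρ hρ
    rw [Set.Finite.mem_toFinset] at hρ
    exact hSZ ρ hρ.1 hρ.2.2.2.1

/-- **Window count from Riemann–von Mangoldt.** There are `C > 0` and `T₁ ≥ 1` with
`N(t + V) − N(t) ≥ (V/2π)(log t − 3) − C (2 log t + 1)` whenever `T₁ ≤ t` and `0 ≤ V ≤ t`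
(from the tree theorem `riemann_von_mangoldt_holds`). -/
theorem exists_zetaZeroCount_window_ge :
    ∃ C T₁ : ℝ, 0 < C ∧ 1 ≤ T₁ ∧ ∀ t V : ℝ, T₁ ≤ t → 0 ≤ V → V ≤ t →
      V / (2 * π) * (Real.log t - 3) - C * (2 * Real.log t + 1) ≤
        (zetaZeroCount (t + V) : ℝ) - zetaZeroCount t := by
  have h := riemann_von_mangoldt_holds
  rw [riemann_von_mangoldt, Asymptotics.isBigO_iff] at h
  obtain ⟨c, hc⟩ := h
  obtain ⟨T₀, hT₀⟩ := Filter.eventually_atTop.1 hc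
  refine ⟨max c 1, max T₀ 1, by positivity, le_max_right _ _, ?_⟩
  intro t V ht hV hVt
  have hT₀t : T₀ ≤ t := le_trans (le_max_left _ _) ht
  have ht1 : 1 ≤ t := le_trans (le_max_right _ _) ht
  have ht0 : 0 < t := by linarith
  have hπ : 0 < π := Real.pi_pos
  have hC0 : 0 ≤ max c 1 := le_trans zero_le_one (le_max_right _ _)
  have hb : ∀ T : ℝ, T₀ ≤ T → 1 ≤ T →
      |(zetaZeroCount T : ℝ) - (T / (2 * π) * Real.log (T / (2 * π)) - T / (2 * π))| ≤
        max c 1 * Real.log T := by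
    intro T hT hT1
    have h1 := hT₀ T hT
    rw [Real.norm_eq_abs, Real.norm_eq_abs, abs_of_nonneg (Real.log_nonneg hT1)] at h1
    exact h1.trans (mul_le_mul_of_nonneg_right (le_max_left _ _) (Real.log_nonneg hT1))
  have h_t := hb t hT₀t ht1
  have h_tV := hb (t + V) (by linarith) (by linarith)
  rw [Real.log_div ht0.ne' (by positivity)] at h_t
  rw [Real.log_div (by positivity) (by positivity)] at h_tV
  rw [abs_le] at h_t h_tV
  have hmono : Real.log t ≤ Real.log (t + V) := Real.log_le_log ht0 (by linarith)
  have hlogtV : Real.log (t + V) ≤ Real.log t + 1 := by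
    have h2t : t + V ≤ 2 * t := by linarith
    calc Real.log (t + V) ≤ Real.log (2 * t) := Real.log_le_log (by linarith) h2t
      _ = Real.log 2 + Real.log t := Real.log_mul (by norm_num) ht0.ne'
      _ ≤ Real.log t + 1 := by linarith [Real.log_two_lt_d9]
  have hP1 : t / (2 * π) * Real.log t ≤ t / (2 * π) * Real.log (t + V) :=
    mul_le_mul_of_nonneg_left hmono (by positivity)
  have hP2 : V / (2 * π) * Real.log t ≤ V / (2 * π) * Real.log (t + V) :=
    mul_le_mul_of_nonneg_left hmono (by positivity)
  have hP3 : V / (2 * π) * Real.log (2 * π) ≤ V / (2 * π) * 2 :=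
    mul_le_mul_of_nonneg_left LittlewoodAverage.log_two_pi_le_two (by positivity)
  have hP4 : max c 1 * Real.log (t + V) ≤ max c 1 * (Real.log t + 1) :=
    mul_le_mul_of_nonneg_left hlogtV hC0
  obtain ⟨h1, -⟩ := h_tV
  obtain ⟨-, h2⟩ := h_t
  obtain ⟨w, hw⟩ : ∃ w : ℝ, w = (2 * π)⁻¹ := ⟨_, rfl⟩
  simp only [div_eq_mul_inv] at h1 h2 hP1 hP2 hP3 ⊢
  rw [← hw] at h1 h2 hP1 hP2 hP3 ⊢
  linarith

/-- **The ordinates in a window, under RH + (SZ).** For `V ≥ 0` there is a finite set of real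
numbers `γ` with `t < γ ≤ t + V`, `ζ(½ + iγ) = 0`, of cardinality exactly `N(t+V) − N(t)`. -/
theorem exists_finset_ordinates_window (hRH : RiemannHypothesis)
    (hSZ : ∀ ρ : ℂ, riemannZeta ρ = 0 → 0 < ρ.im → riemannZetaZeroOrder ρ = 1)
    {t V : ℝ} (hV : 0 ≤ V) :
    ∃ S : Finset ℝ, (∀ γ ∈ S, t < γ ∧ γ ≤ t + V ∧ riemannZeta (1 / 2 + γ * I) = 0) ∧
      (S.card : ℝ) = zetaZeroCount (t + V) - zetaZeroCount t := by
  classical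
  obtain ⟨B, hBdef⟩ : ∃ B : Finset ℂ, B = (zetaZeroBox_finite 0 (t + V)).toFinset := ⟨_, rfl⟩
  have hmemB : ∀ ρ : ℂ, ρ ∈ B ↔
      riemannZeta ρ = 0 ∧ 0 ≤ ρ.re ∧ ρ.re ≤ 1 ∧ 0 < ρ.im ∧ ρ.im ≤ t + V := by
    intro ρ
    rw [hBdef, Set.Finite.mem_toFinset]
    rfl
  have hre : ∀ ρ ∈ B, ρ.re = 1 / 2 := by
    intro ρ hρ
    obtain ⟨hz, -, -, him, -⟩ := (hmemB ρ).1 hρ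
    refine hRH ρ hz ?_ ?_
    · rintro ⟨n, hn⟩
      have h0 : ρ.im = 0 := by rw [hn]; simp
      linarith
    · rintro rfl
      simp at him
  have heq : ∀ ρ ∈ B, (1 / 2 : ℂ) + ((ρ.im : ℝ) : ℂ) * I = ρ := by
    intro ρ hρ
    apply Complex.ext <;> simp [hre ρ hρ]
  refine ⟨(B.filter (fun ρ ↦ t < ρ.im)).image Complex.im, ?_, ?_⟩
  · intro γ hγ
    obtain ⟨ρ, hρF, rfl⟩ := Finset.mem_image.1 hγ
    obtain ⟨hρB, hρt⟩ := Finset.mem_filter.1 hρF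
    obtain ⟨hz, -, -, -, hle⟩ := (hmemB ρ).1 hρB
    exact ⟨hρt, hle, by rw [heq ρ hρB]; exact hz⟩
  · have hinj : Set.InjOn Complex.im ((B.filter (fun ρ ↦ t < ρ.im)) : Set ℂ) := by
      intro ρ₁ h₁ ρ₂ h₂ h
      have h₁B := (Finset.mem_filter.1 (Finset.mem_coe.1 h₁)).1
      have h₂B := (Finset.mem_filter.1 (Finset.mem_coe.1 h₂)).1
      rw [← heq ρ₁ h₁B, ← heq ρ₂ h₂B, h]
    rw [Finset.card_image_of_injOn hinj]
    have hneg : B.filter (fun ρ ↦ ¬ t < ρ.im) = (zetaZeroBox_finite 0 t).toFinset := by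
      ext ρ
      rw [Finset.mem_filter, hmemB, Set.Finite.mem_toFinset]
      simp only [zetaZeroBox, Set.mem_setOf_eq, not_lt]
      constructor
      · rintro ⟨⟨hz, h0, h1, him, -⟩, hle⟩
        exact ⟨hz, h0, h1, him, hle⟩
      · rintro ⟨hz, h0, h1, him, hle⟩
        exact ⟨⟨hz, h0, h1, him, by linarith⟩, hle⟩
    have hcard := Finset.card_filter_add_card_filter_not (s := B) (fun ρ ↦ t < ρ.im)
    rw [hneg] at hcard
    rw [zetaZeroCount_eq_card_of_simple hSZ, zetaZeroCount_eq_card_of_simple hSZ, ← hBdef]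
    have hcast : ((B.filter (fun ρ ↦ t < ρ.im)).card : ℝ) +
        ((zetaZeroBox_finite 0 t).toFinset.card : ℝ) = B.card := by
      exact_mod_cast hcard
    linarith

/-- Numeric step of the count: `L ≥ 12 + 80 C`, `V ≥ L²` give
`V L/(4π) ≤ (V/2π)(L − 3) − C(2L + 1)`. -/
theorem windowCount_numeric {L V C : ℝ} (hC : 0 ≤ C) (hL : 12 + 80 * C ≤ L) (hV : L ^ 2 ≤ V) :
    1 / (4 * π) * V * L ≤ V / (2 * π) * (L - 3) - C * (2 * L + 1) := by
  have hπ : 0 < π := Real.pi_pos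
  have hπ3 : π < 3.15 := Real.pi_lt_d2
  have hL12 : 12 ≤ L := by linarith
  have hL0 : 0 ≤ L := by linarith
  have hL80 : 80 * C ≤ L := by linarith
  have hCL : 0 ≤ C * L := mul_nonneg hC hL0
  have h1 : L ^ 2 * (L - 6) ≤ V * (L - 6) := mul_le_mul_of_nonneg_right hV (by linarith)
  have h2 : L ^ 2 * (L / 2) ≤ L ^ 2 * (L - 6) :=
    mul_le_mul_of_nonneg_left (by linarith) (sq_nonneg L)
  have h3 : 80 * C * L ≤ L * L := mul_le_mul_of_nonneg_right hL80 hL0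
  have h4 : L * L * 12 ≤ L * L * L := mul_le_mul_of_nonneg_left hL12 (mul_nonneg hL0 hL0)
  have h5 : 4 * π * (C * (2 * L + 1)) ≤ 4 * π * (3 * (C * L)) :=
    mul_le_mul_of_nonneg_left (by nlinarith) (by positivity)
  have h6 : 4 * π * (3 * (C * L)) ≤ 38 * (C * L) := by nlinarith
  have hsq : L ^ 2 = L * L := sq L
  have key : 4 * π * (C * (2 * L + 1)) ≤ V * (L - 6) := by nlinarith
  have hid : V / (2 * π) * (L - 3) - C * (2 * L + 1) - 1 / (4 * π) * V * L =
      (V * (L - 6) - 4 * π * (C * (2 * L + 1))) / (4 * π) := by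
    field_simp
    ring
  rw [← sub_nonneg, hid]
  exact div_nonneg (by linarith) (by positivity)

/-- **RH + (SZ) + (SG_k) ⟹ (AC*)** with exponent `n = 2` and constant `c = 1/(4π)`: beyond some
height, every window `[t, t + V]` with `(log t)² ≤ V ≤ t` contains at least `V log V/(4π)`
ordinates of zeros, pairwise at least `e^{-V}` apart. -/
theorem anticlustering_of_simple_separated_zeros (hRH : RiemannHypothesis)
    (hSZ : ∀ ρ : ℂ, riemannZeta ρ = 0 → 0 < ρ.im → riemannZetaZeroOrder ρ = 1)
    {k : ℕ} {t₀ : ℝ}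
    (hSG : ∀ γ γ' : ℝ, t₀ ≤ γ → t₀ ≤ γ' → γ ≠ γ' → riemannZeta (1 / 2 + γ * I) = 0 →
      riemannZeta (1 / 2 + γ' * I) = 0 → (max γ γ' ^ k)⁻¹ ≤ |γ - γ'|) :
    ∃ tstar : ℝ, ∀ t V : ℝ, tstar ≤ t → Real.log t ^ 2 ≤ V → V ≤ t →
      ∃ S : Finset ℝ, (∀ γ ∈ S, t ≤ γ ∧ γ ≤ t + V ∧ riemannZeta (1 / 2 + γ * I) = 0) ∧
        (∀ γ ∈ S, ∀ γ' ∈ S, γ ≠ γ' → Real.exp (-V) ≤ |γ - γ'|) ∧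
        1 / (4 * π) * V * Real.log V ≤ S.card := by
  obtain ⟨C, T₁, hC, -, hcount⟩ := exists_zetaZeroCount_window_ge
  refine ⟨max (max T₁ t₀) (Real.exp (12 + 80 * C + k)), ?_⟩
  intro t V ht hVlo hVt
  have hT₁t : T₁ ≤ t := le_trans (le_trans (le_max_left _ _) (le_max_left _ _)) ht
  have ht₀t : t₀ ≤ t := le_trans (le_trans (le_max_right _ _) (le_max_left _ _)) ht
  have hexp : Real.exp (12 + 80 * C + k) ≤ t := le_trans (le_max_right _ _) ht
  have ht0 : 0 < t := lt_of_lt_of_le (Real.exp_pos _) hexp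
  have hL : 12 + 80 * C + k ≤ Real.log t := by
    rw [← Real.log_exp (12 + 80 * C + k)]
    exact Real.log_le_log (Real.exp_pos _) hexp
  have hk0 : (0 : ℝ) ≤ k := Nat.cast_nonneg k
  have hL12 : 12 ≤ Real.log t := by linarith
  have hV0 : 0 < V := lt_of_lt_of_le (pow_pos (by linarith) 2) hVlo
  obtain ⟨S, hmem, hcard⟩ := exists_finset_ordinates_window hRH hSZ (t := t) (V := V) hV0.le
  refine ⟨S, fun γ hγ ↦ ⟨(hmem γ hγ).1.le, (hmem γ hγ).2.1, (hmem γ hγ).2.2⟩, ?_, ?_⟩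
  · intro γ hγ γ' hγ' hne
    obtain ⟨hγt, hγV, hγz⟩ := hmem γ hγ
    obtain ⟨hγ't, hγ'V, hγ'z⟩ := hmem γ' hγ'
    have hsep := hSG γ γ' (by linarith) (by linarith) hne hγz hγ'z
    refine le_trans ?_ hsep
    have hm0 : 0 < max γ γ' := lt_of_lt_of_le (by linarith) (le_max_left _ _)
    have hm2 : max γ γ' ≤ 2 * t := max_le (by linarith) (by linarith)
    have h2t : 0 < 2 * t := by linarith
    have hpow : max γ γ' ^ k ≤ (2 * t) ^ k := pow_le_pow_left₀ hm0.le hm2 k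
    have hpow0 : 0 < max γ γ' ^ k := pow_pos hm0 k
    have hklog : (k : ℝ) * Real.log (2 * t) ≤ V := by
      have hl2t : Real.log (2 * t) = Real.log 2 + Real.log t := Real.log_mul (by norm_num) ht0.ne'
      rw [hl2t]
      have h1 : (k : ℝ) * (Real.log 2 + Real.log t) ≤ k * (1 + Real.log t) :=
        mul_le_mul_of_nonneg_left (by linarith [Real.log_two_lt_d9]) hk0
      have h2 : (k : ℝ) * (1 + Real.log t) ≤ Real.log t * (1 + k) := by
        have : (k : ℝ) ≤ Real.log t := by linarith
        nlinarith
      have h3 : Real.log t * (1 + k) ≤ Real.log t * Real.log t :=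
        mul_le_mul_of_nonneg_left (by linarith) (by linarith)
      have h4 : Real.log t * Real.log t = Real.log t ^ 2 := (sq _).symm
      linarith
    calc Real.exp (-V) ≤ Real.exp (-((k : ℝ) * Real.log (2 * t))) :=
          Real.exp_le_exp.2 (by linarith)
      _ = ((2 * t) ^ k)⁻¹ := by rw [Real.exp_neg, Real.exp_nat_mul, Real.exp_log h2t]
      _ ≤ (max γ γ' ^ k)⁻¹ := inv_anti₀ hpow0 hpow
  · have hwin := hcount t V hT₁t hV0.le hVt
    have hnum := windowCount_numeric hC.le (by linarith : 12 + 80 * C ≤ Real.log t) hVlo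
    have hlogV : Real.log V ≤ Real.log t := Real.log_le_log hV0 hVt
    have hlogV' : 1 / (4 * π) * V * Real.log V ≤ 1 / (4 * π) * V * Real.log t :=
      mul_le_mul_of_nonneg_left hlogV (by positivity)
    linarith

/-- **THEOREM (T69).** RH, simplicity of the zeros and a polynomial lower bound
`|γ − γ'| ≥ (max γ γ')^{-k}` on the gaps between distinct ordinates imply the double-exponential
lower size law `Re Q(g) ≥ exp(−exp(A a))` for unit Weil test functions supported in `[-a, a]`,
`a ≥ 1` (T68 with (AC*) discharged by `anticlustering_of_simple_separated_zeros`). -/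
theorem weilQuadratic_re_ge_exp_neg_exp_of_simple_separated_zeros (hRH : RiemannHypothesis)
    (hSZ : ∀ ρ : ℂ, riemannZeta ρ = 0 → 0 < ρ.im → riemannZetaZeroOrder ρ = 1)
    {k : ℕ} {t₀ : ℝ}
    (hSG : ∀ γ γ' : ℝ, t₀ ≤ γ → t₀ ≤ γ' → γ ≠ γ' → riemannZeta (1 / 2 + γ * I) = 0 →
      riemannZeta (1 / 2 + γ' * I) = 0 → (max γ γ' ^ k)⁻¹ ≤ |γ - γ'|) :
    ∃ A : ℝ, 0 < A ∧ ∀ a : ℝ, 1 ≤ a → ∀ g : ℝ → ℂ, IsWeilTest g → tsupport g ⊆ Icc (-a) a →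
      ∫ t, ‖g t‖ ^ 2 = (1 : ℝ) → Real.exp (-Real.exp (A * a)) ≤ (weilQuadratic g).re := by
  obtain ⟨tstar, hAC⟩ := anticlustering_of_simple_separated_zeros hRH hSZ hSG
  exact weilQuadratic_re_ge_exp_neg_exp_of_anticlustering hRH (c := 1 / (4 * π)) (n := 2)
    (tstar := tstar) (by positivity) (by norm_num) hAC

end Summit.RiemannHypothesis.RiemannHypothesis.Theorems
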